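/-
Copyright: statement-level skeleton of a published paper (lit-balaban cell, Phase-2 proof seat p31, gen 24). No proof claims beyond what the
kernel checks below.
-/
import Literature.MathematicalPhysics.QuantumFieldTheory.BalabanImbrieJaffe1984to88.BIJ88Eq249GaugeCovarianceTorus
import Literature.MathematicalPhysics.QuantumFieldTheory.BalabanImbrieJaffe1984to88.BIJ88Locality246Lattice

/-!
# `BalabanImbrieJaffe1984to88.BIJ88Eq248GaugeCovarianceTorus` — T. Bałaban, J. Imbrie, A. Jaffe, *Effective action and cluster properties of the
abelian Higgs model*, Commun. Math. Phys. **114** (1988) 257–315 [BalabanImbrieJaffe1988], §2 p. 265 [PDF 9], **(2.48) FOR THE GAUGE-FIELD COVARIANCE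
PIECES OF (2.49)**: *"If X does not intersect Λ^c then C^{(k)}_{Λ,X}(u) does not depend on Λ; neither does C^{(k)}_{Λ,loc}(u; x₁, x₂) depend on Λ if
dist({x₁,x₂}, Λ^c) > ½r(e_k). In this case we write it as C^{(k)}_{loc}(u; x₁, x₂) = C^{(k)}_{Λ,loc}(u; x₁, x₂), Λ large enough. (2.48)"* — read, through
(2.49) *"analogous to (2.45), with similar estimates"*, for the pieces `C^{(k)}_{Λ,loc} = C_Λ·C_{loc}[A(Λ)]·C_Λᵀ`, `C^{(k)}_{Λ,X} = C_Λ·C_X[A(Λ)]·C_Λᵀ` of the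
gauge-field covariance `C^{(k)}_Λ = C_Λ(C_Λ*Δ_kC_Λ)⁻¹C_Λ*` of [Balaban1984PropagatorsII] (2.156) built in gen 24's `BIJ88Eq249GaugeCovarianceTorus`: THE
Λ-INDEPENDENCE OF BOTH PIECES, termwise (any `Δ`, any `γ`, any cube size, no (5.6)), from p13's locality theorems `BIJ88Locality246Lattice.cLoc_congr_local`
/ `cX_congr_local` (two operators agreeing on a site set have the same local / `X`-parts there) applied to the [6]-operators `A(Λ₁)`, `A(Λ₂)` of two
regions — which agree wherever the two regions have the same remaining variables, because the middle factor `CᵀΔ_kC` does not see `Λ` at all (pv09: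
`C_Λ` is the column restriction of ONE torus matrix `C`).

statement-level skeleton of published theorems with citation tags; proofs where landed; nothing here is a claim about the Yang–Mills mass gap

PDF held: `paper:balaban1988-cmp114-bij-abelian-higgs-effective-action` (journal page = PDF page + 256; p. 265 = PDF 9 re-read this session, `lit read … --pages 8-10`).

CITATION HEADER (lean-in-tree rule).  lit-balaban cell (HOME `run/shared/lean/pub/lit-balaban/`), Phase 2, proof seat **p31 gen 24** (unit `lit-balaban-p31`,
literature-prover-lit-balaban-p31-g24-0), free-target protocol G.5-34(d), TAKING #2 line HOME/STATUS.md (window 20 min; stem check `248Gauge` = ∅; cc r18, p13).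
Rows of `HOME/lit-balaban-r18/ROWS-C2.md` served (LOCATED MEMBERS, cells only; heads unchanged — C2.Eq2.48 is `proved` through p13's ℤ^d instance): **C2.Eq2.48**
(both clauses, gauge-field analog) and **C2.Eq2.49**.  Files USED BY NAME, nothing restated: gen 24 `BIJ88Eq249GaugeCovarianceTorus` (`opA`, `sandw`, `walkK`),
p13 `BIJ88Locality246Lattice` (`AgreeOn`, `nbhd`, `mem_nbhd`, `sitesOf`, `boxSet_subset_sitesOf`, `cLoc_congr_local`, `cX_congr_local`), `BIJ88RandomWalk242`
(`cLoc`, `cX`, `memX`, `cX_support`, `subset_closure`), `BIJ88Ineq246Lattice` (`ldist`, `cubeOf`, `touch`, `Cubes`, `latticeCw_support`), `B4Sect5CubeBounds`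
(`labels`, `InBox`, `mem_boxSet`); pub-balaban pv09 `B6BondElimination` (`pad_mem_mem`, `pad_mem_not`, `pad_not`), `B6Cov2156Torus` (`freeT`, `elimT`,
`elimT_range`, `one_le_M`), `B6Cov2156TorusSubset` (`lamFree`, `lamFree_subset`, `elimLam`, `IsLam`, `mem_lamFree`), `B6BondEliminationTorus` (`pdist`,
`pdist_le_dist`), `B4Sect5Torus` (`tdist_triangle`, `tdist_symm`).

## What is proved (0 `sorry`; axioms standard; theorems only)

* §1 `sandw_eq_sum_E` (the `C_Λ`-sandwich as a double sum over the remaining variables with the Λ-FREE outer factor `C(b, p)` = pv09's `elimT` read on all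
  box variables), `pdist_le_of_E_ne_zero` (its torus range `L − 1`), **`opA_congr`** (the padded operators of two regions agree at every entry whose two
  variables have the same remaining-variable status in both), **`agreeOn_opA`** (same `Λ`-bonds at the sites of `S` ⇒ p13's `AgreeOn S (A(Λ₁)) (A(Λ₂))`).
* §2 **`cLoc_opA_congr`** / **`cX_opA_congr`**: the local part at `(p, q)` / the `X`-part of the walk expansion of `A(Λ)` is the same for two regions with the
  same `Λ`-bonds within `(ρ+1)M_c` (box distance) of `p` and `q` / at the sites of `X` (p13 BY NAME).
* §3 **`gLoc_congr`** — (2.48) second clause for the gauge field: `C^{(k)}_{Λ₁,loc}(b,b′) = C^{(k)}_{Λ₂,loc}(b,b′)` whenever `Λ₁`, `Λ₂` have the same `Λ`-bonds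
  at every site within TORUS distance `(ρ+1)M_c + (L−1)` of `b` or `b′` (`ρ ≥ 0`; print: `ρM_c = ¼r(e_k)`, radius `≤ ½r(e_k)`), with the located form
  **`gLoc_eq_of_contains`** (*"Λ large enough"*: both regions contain that neighbourhood); **`gX_congr`** — (2.48) first clause: `C^{(k)}_{Λ₁,X} = C^{(k)}_{Λ₂,X}`
  (all entries) whenever `Λ₁`, `Λ₂` have the same `Λ`-bonds at the sites of `X`, with **`gX_eq_of_contains`** (*"If X does not intersect Λ^c"*); helper
  `mem_sitesOf_of_memX`.
* §4 NON-VACUITY of gen 24's half-torus hypothesis: `corner_wrap_succ_bounds` (the block corner of the wrapped successor site), **`halfBox_of_blocks_in_window`**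
  (every point of `Λ′₀` with its block in a coordinate window `[a_μ, a_μ + w_μ)`, `a_μ ≥ 1`, `2(w_μ + 1) ≤ M_μ` ⇒ `HalfBox L M Λ′₀`).
* §5 *"Λ large enough"* up to the whole torus: `cov_subFamilyT_freeT`, **`covLam_univ_eq`** (for `Λ′₀ ⊇ T′` the Λ-covariance IS pv09's whole-torus
  (2.156) `bondReductionT … .cov`) and **`covLam_univ_eq_unitPropagator`** (on the tori `Params`, `d ≥ 2`, `k + 1 ≤ m + K`, it IS the kernel of the (4.3.3)
  propagator of [I] in Bałaban's axial gauge — p09's `kernel_corner_eq_cov` BY NAME): the family expanded in gen 24 is the family of *"the single-step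
  covariance for the gauge field"*; its whole-torus member is outside the half-torus hypothesis of the walk theorems (recorded, not hidden).
HONEST SCOPE.  (i) Termwise identities: no convergence, no (5.6), no half-torus position needed; they concern the PIECES as defined in
`BIJ88Eq249GaugeCovarianceTorus` (whose identity (2.49) and estimates do need those hypotheses).  (ii) "Λ-bonds at a site" = pv09's `IsLam L M Λ′₀` of the
bond variables based there (a bond with an end-point in `B(Λ′₀)` modulo the periods); distances to `b, b′` in the TORUS distance (`C` couples within `L − 1`
of it), p13's neighbourhoods in the box distance (dominating the torus one).  (iii) No background field `u`.  No `def`, no new named fact (D-0026).  Unit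
`lit-balaban-p31` (literature-prover-lit-balaban-p31-g24-0), 2026-08-23.  NOT summit progress.
-/

open scoped BigOperators Matrix
open Finset Matrix

namespace Literature.MathematicalPhysics.QuantumFieldTheory.BalabanImbrieJaffe1984to88.BIJ88Eq248GaugeCovarianceTorus

open Literature.MathematicalPhysics.QuantumFieldTheory.Balaban1983to89
open B6BondElimination (pad pad_mem_mem pad_mem_not pad_not)
open B6BondEliminationTorus (pdist pdist_le_dist)
open B6Lemma24Torus (pbox)
open B6Cov2156Torus (freeT elimT elimT_range one_le_M)
open B6Cov2156TorusSubset (elimTS lamFree lamFree_subset elimLam bondReductionLam IsLam mem_lamFree)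
open BIJ88RandomWalk242 BIJ88Eq242Lattice BIJ88Ineq246Lattice BIJ88Locality246Lattice B4Sect5CubeBounds
open BIJ88Eq249GaugeCovarianceTorus

noncomputable section

variable {d L : ℕ} {M : Fin d → ℕ}

/-! ## §1 The outer factor `C_Λ` does not depend on `Λ`; the padded operator depends on `Λ` only through the set of remaining variables -/

/-- kernel: the `C_Λ`-sandwich as a double `Finset` sum over the remaining variables with the Λ-free outer factor.
[cite: Balaban1984PropagatorsII, (2.156) p.250] -/
theorem sandw_eq_sum_E {Λ'₀ : Finset (Fin d → ℤ)} (K : B4.Idx (pbox M) d → B4.Idx (pbox M) d → ℝ) (b b' : B4.Idx (pbox M) d) :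
    sandw L M Λ'₀ K b b' = ∑ q ∈ lamFree L M Λ'₀, ∑ p ∈ lamFree L M Λ'₀,
      (if hp : p ∈ freeT L M then elimT L M b ⟨p, hp⟩ else 0) * K p q * (if hq : q ∈ freeT L M then elimT L M b' ⟨q, hq⟩ else 0) := by
  unfold sandw
  rw [← Finset.sum_coe_sort (lamFree L M Λ'₀)]
  refine Finset.sum_congr rfl fun k' _ => ?_
  rw [Finset.sum_mul, ← Finset.sum_coe_sort (lamFree L M Λ'₀)]
  refine Finset.sum_congr rfl fun k _ => ?_
  rw [dif_pos (lamFree_subset L M Λ'₀ k.2), dif_pos (lamFree_subset L M Λ'₀ k'.2)]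
  rfl

variable [∀ μ, NeZero (M μ)]

/-- kernel: a non-zero Λ-free outer factor `C(b, p)` forces `ρ_M(b, p) ≤ L − 1` (pv09's `elimT_range`). [cite: Balaban1984PropagatorsII, p.250] -/
theorem pdist_le_of_E_ne_zero (hL : 0 < L) {b p : B4.Idx (pbox M) d}
    (h : (if hp : p ∈ freeT L M then elimT L M b ⟨p, hp⟩ else 0) ≠ 0) :
    pdist M (one_le_M M) (b.1 : Fin d → ℤ) (p.1 : Fin d → ℤ) ≤ (L : ℝ) - 1 := by
  by_cases hp : p ∈ freeT L M
  · rw [dif_pos hp] at h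
    exact elimT_range hL b ⟨p, hp⟩ h
  · rw [dif_neg hp] at h
    exact absurd rfl h

omit [∀ μ, NeZero (M μ)] in
/-- kernel: THE PADDED OPERATORS OF TWO REGIONS AGREE at every entry whose two variables have the same remaining-variable status in both
(the middle factor `CᵀΔC` is Λ-free; the padding sees only membership). [cite: BalabanImbrieJaffe1988, (2.48) p.265; Balaban1984PropagatorsII, (2.156) p.250] -/
theorem opA_congr {Λ₁ Λ₂ : Finset (Fin d → ℤ)} (Δ : Matrix (B4.Idx (pbox M) d) (B4.Idx (pbox M) d) ℝ) (γ : ℝ)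
    {p q : B4.Idx (pbox M) d} (hp : p ∈ lamFree L M Λ₁ ↔ p ∈ lamFree L M Λ₂) (hq : q ∈ lamFree L M Λ₁ ↔ q ∈ lamFree L M Λ₂) :
    opA L M Λ₁ Δ γ p q = opA L M Λ₂ Δ γ p q := by
  unfold opA
  by_cases h1 : p ∈ lamFree L M Λ₁
  · have h2 : p ∈ lamFree L M Λ₂ := hp.1 h1
    by_cases h1q : q ∈ lamFree L M Λ₁
    · have h2q : q ∈ lamFree L M Λ₂ := hq.1 h1q
      rw [pad_mem_mem _ _ h1 h1q, pad_mem_mem _ _ h2 h2q]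
      simp only [Matrix.mul_apply, Matrix.transpose_apply]
      rfl
    · have h2q : q ∉ lamFree L M Λ₂ := fun h => h1q (hq.2 h)
      rw [pad_mem_not _ _ h1 h1q, pad_mem_not _ _ h2 h2q]
  · have h2 : p ∉ lamFree L M Λ₂ := fun h => h1 (hp.2 h)
    rw [pad_not _ _ h1, pad_not _ _ h2]

omit [∀ μ, NeZero (M μ)] in
/-- kernel: if `Λ₁` and `Λ₂` have the same `Λ`-bonds at the sites of `S` (pv09's `IsLam`), their padded operators AGREE ON `S` in p13's sense
(`BIJ88Locality246Lattice.AgreeOn`). [cite: BalabanImbrieJaffe1988, (2.48) p.265] -/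
theorem agreeOn_opA {Λ₁ Λ₂ : Finset (Fin d → ℤ)} (Δ : Matrix (B4.Idx (pbox M) d) (B4.Idx (pbox M) d) ℝ) (γ : ℝ)
    {S : Finset (Fin d → ℤ)} (hS : ∀ p : B4.Idx (pbox M) d, (p.1 : Fin d → ℤ) ∈ S → (IsLam L M Λ₁ p ↔ IsLam L M Λ₂ p)) :
    AgreeOn S (opA L M Λ₁ Δ γ) (opA L M Λ₂ Δ γ) := by
  intro p q hp hq
  refine opA_congr Δ γ ?_ ?_
  · rw [mem_lamFree, mem_lamFree, hS p hp]
  · rw [mem_lamFree, mem_lamFree, hS q hq]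

/-! ## §2 The middle factors: local parts and `X`-parts of `A(Λ)` see `Λ` only locally (p13's `cLoc_congr_local` / `cX_congr_local`) -/

omit [∀ μ, NeZero (M μ)] in
/-- **(2.48) second clause at the level of the [6]-operator**: the local part of the walk expansion of `A(Λ)` at `(p, q)` is the same for two
regions having the same `Λ`-bonds at the sites within `(ρ+1)M_c` (box distance) of `p` and of `q`. [cite: BalabanImbrieJaffe1988, (2.48) p.265, (2.43) p.264] -/
theorem cLoc_opA_congr {Λ₁ Λ₂ : Finset (Fin d → ℤ)} (Δ : Matrix (B4.Idx (pbox M) d) (B4.Idx (pbox M) d) ℝ) (γ : ℝ) {Mc : ℕ}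
    (hM0 : 0 < Mc) (ρ : ℝ) (p q : B4.Idx (pbox M) d)
    (hS : ∀ r : B4.Idx (pbox M) d, (r.1 : Fin d → ℤ) ∈ nbhd Mc ρ p ∩ nbhd Mc ρ q → (IsLam L M Λ₁ r ↔ IsLam L M Λ₂ r)) :
    cLoc (ldist (N := d) Mc) ρ (walkK L M Λ₁ Δ γ Mc) p q = cLoc (ldist (N := d) Mc) ρ (walkK L M Λ₂ Δ γ Mc) p q :=
  cLoc_congr_local hM0 ρ p q (agreeOn_opA Δ γ hS)

omit [∀ μ, NeZero (M μ)] in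
/-- **(2.48) first clause at the level of the [6]-operator**: the `X`-part of the walk expansion of `A(Λ)` is the same for two regions having
the same `Λ`-bonds at the sites of `X` (p13's `sitesOf`). [cite: BalabanImbrieJaffe1988, (2.48) p.265, (2.46) p.264] -/
theorem cX_opA_congr {Λ₁ Λ₂ : Finset (Fin d → ℤ)} (Δ : Matrix (B4.Idx (pbox M) d) (B4.Idx (pbox M) d) ℝ) (γ : ℝ) {Mc : ℕ}
    (hM0 : 0 < Mc) (ρ : ℝ) {s : ℕ} (X : Finset (Cubes Mc s (pbox M))) (p q : B4.Idx (pbox M) d)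
    (hS : ∀ r : B4.Idx (pbox M) d, (r.1 : Fin d → ℤ) ∈ sitesOf Mc s X → (IsLam L M Λ₁ r ↔ IsLam L M Λ₂ r)) :
    cX (ldist (N := d) Mc) ρ (cubeOf Mc s) touch (walkK L M Λ₁ Δ γ Mc) X p q =
      cX (ldist (N := d) Mc) ρ (cubeOf Mc s) touch (walkK L M Λ₂ Δ γ Mc) X p q :=
  cX_congr_local hM0 ρ X p q (agreeOn_opA Δ γ hS)

/-! ## §3 The sandwiches: (2.48) for the gauge-field pieces `C^{(k)}_{Λ,loc}`, `C^{(k)}_{Λ,X}` -/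

omit [∀ μ, NeZero (M μ)] in
/-- kernel: two double sums over two finite sets of the SAME summand agree when the summand vanishes off the pairs whose members have the
same membership in both sets. [folklore] (private bookkeeping) -/
private theorem sum_sum_eq_of_support {ι : Type*} [DecidableEq ι] {F₁ F₂ : Finset ι} (g : ι → ι → ℝ)
    (h : ∀ p q, g p q ≠ 0 → (p ∈ F₁ ↔ p ∈ F₂) ∧ (q ∈ F₁ ↔ q ∈ F₂)) :
    ∑ q ∈ F₁, ∑ p ∈ F₁, g p q = ∑ q ∈ F₂, ∑ p ∈ F₂, g p q := by
  have key : ∀ {G₁ G₂ : Finset ι}, (∀ p q, g p q ≠ 0 → (p ∈ G₁ ↔ p ∈ G₂) ∧ (q ∈ G₁ ↔ q ∈ G₂)) →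
      ∑ q ∈ G₁, ∑ p ∈ G₁, g p q = ∑ q ∈ G₁ ∩ G₂, ∑ p ∈ G₁ ∩ G₂, g p q := by
    intro G₁ G₂ hG
    symm
    rw [Finset.sum_subset Finset.inter_subset_left]
    · refine Finset.sum_congr rfl fun q hq => ?_
      refine Finset.sum_subset Finset.inter_subset_left fun p hp hpn => ?_
      by_contra hne
      exact hpn (Finset.mem_inter.2 ⟨hp, ((hG p q hne).1).1 hp⟩)
    · intro q hq hqn
      refine Finset.sum_eq_zero fun p hp => ?_
      by_contra hne
      exact hqn (Finset.mem_inter.2 ⟨hq, ((hG p q hne).2).1 hq⟩)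
  rw [key h, key (fun p q hne => ⟨((h p q hne).1).symm, ((h p q hne).2).symm⟩), Finset.inter_comm]

/-- **(2.48) FOR THE GAUGE-FIELD LOCAL PART** (p. 265: *"neither does C^{(k)}_{Λ,loc}(u; x₁, x₂) depend on Λ if dist({x₁,x₂}, Λ^c) > ½r(e_k). In this
case we write it as C^{(k)}_{loc}(u; x₁, x₂) = C^{(k)}_{Λ,loc}(u; x₁, x₂), Λ large enough. (2.48)"*, applied through (2.49) *"analogous to (2.45), with
similar estimates"*): for ANY `Δ`, `γ`, cubes `M_c ≥ 1`, radius `ρ` and two regions `Λ₁ = B(Λ′₁)`, `Λ₂ = B(Λ′₂)` having the same `Λ`-bonds at every site within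
TORUS distance `(ρ+1)M_c + (L − 1)` of `b` or of `b′`: `C^{(k)}_{Λ₁,loc}(b, b′) = C^{(k)}_{Λ₂,loc}(b, b′)` — termwise, no (5.6). (In the print's letters
`ρM_c = ¼r(e_k)`, so the radius is `¼r(e_k) + M_c + L ≤ ½r(e_k)`.) [cite: BalabanImbrieJaffe1988, (2.48) p.265, (2.49) p.265] -/
theorem gLoc_congr (hL : 0 < L) {Λ₁ Λ₂ : Finset (Fin d → ℤ)} (Δ : Matrix (B4.Idx (pbox M) d) (B4.Idx (pbox M) d) ℝ) (γ : ℝ) {Mc : ℕ}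
    (hM0 : 0 < Mc) {ρ : ℝ} (hρ : 0 ≤ ρ) (b b' : B4.Idx (pbox M) d)
    (hS : ∀ r : B4.Idx (pbox M) d,
      pdist M (one_le_M M) (b.1 : Fin d → ℤ) (r.1 : Fin d → ℤ) ≤ (ρ + 1) * Mc + ((L : ℝ) - 1) ∨
        pdist M (one_le_M M) (b'.1 : Fin d → ℤ) (r.1 : Fin d → ℤ) ≤ (ρ + 1) * Mc + ((L : ℝ) - 1) →
      (IsLam L M Λ₁ r ↔ IsLam L M Λ₂ r)) :
    sandw L M Λ₁ (cLoc (ldist (N := d) Mc) ρ (walkK L M Λ₁ Δ γ Mc)) b b' =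
      sandw L M Λ₂ (cLoc (ldist (N := d) Mc) ρ (walkK L M Λ₂ Δ γ Mc)) b b' := by
  classical
  rw [sandw_eq_sum_E, sandw_eq_sum_E]
  -- the two summands coincide as functions of `(p, q)`
  have hsame : ∀ p q : B4.Idx (pbox M) d,
      (if hp : p ∈ freeT L M then elimT L M b ⟨p, hp⟩ else 0) * cLoc (ldist (N := d) Mc) ρ (walkK L M Λ₁ Δ γ Mc) p q *
          (if hq : q ∈ freeT L M then elimT L M b' ⟨q, hq⟩ else 0) =
        (if hp : p ∈ freeT L M then elimT L M b ⟨p, hp⟩ else 0) * cLoc (ldist (N := d) Mc) ρ (walkK L M Λ₂ Δ γ Mc) p q *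
          (if hq : q ∈ freeT L M then elimT L M b' ⟨q, hq⟩ else 0) := by
    intro p q
    by_cases hp : (if hp : p ∈ freeT L M then elimT L M b ⟨p, hp⟩ else 0) = 0
    · simp only [hp, zero_mul]
    by_cases hq : (if hq : q ∈ freeT L M then elimT L M b' ⟨q, hq⟩ else 0) = 0
    · simp only [hq, mul_zero]
    rw [cLoc_opA_congr Δ γ hM0 ρ p q fun r hr => hS r ?_]
    obtain ⟨hr1, hr2⟩ := Finset.mem_inter.1 hr
    left
    have h1 := (mem_nbhd.1 hr1).2
    have h2 := pdist_le_of_E_ne_zero hL hp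
    have h3 := pdist_le_dist M (one_le_M M) (r.1 : Fin d → ℤ) (p.1 : Fin d → ℤ)
    have h4 := B4Sect5Torus.tdist_triangle (one_le_M M) (B6BondEliminationTorus.res M (one_le_M M) (b.1 : Fin d → ℤ))
      (B6BondEliminationTorus.res M (one_le_M M) (p.1 : Fin d → ℤ)) (B6BondEliminationTorus.res M (one_le_M M) (r.1 : Fin d → ℤ))
    have h5 : pdist M (one_le_M M) (p.1 : Fin d → ℤ) (r.1 : Fin d → ℤ) = pdist M (one_le_M M) (r.1 : Fin d → ℤ) (p.1 : Fin d → ℤ) :=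
      B4Sect5Torus.tdist_symm (one_le_M M) _ _
    unfold pdist at h2 h3 h5 ⊢
    linarith
  simp_rw [hsame]
  refine sum_sum_eq_of_support _ fun p q hne => ?_
  have hp : (if hp : p ∈ freeT L M then elimT L M b ⟨p, hp⟩ else 0) ≠ 0 := fun h =>
    hne (by rw [h, zero_mul, zero_mul])
  have hq : (if hq : q ∈ freeT L M then elimT L M b' ⟨q, hq⟩ else 0) ≠ 0 := fun h =>
    hne (by rw [h, mul_zero])
  have hMc : (0 : ℝ) ≤ (ρ + 1) * Mc := by positivity
  constructor
  · rw [mem_lamFree, mem_lamFree, hS p (Or.inl ((pdist_le_of_E_ne_zero hL hp).trans (by linarith)))]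
  · rw [mem_lamFree, mem_lamFree, hS q (Or.inr ((pdist_le_of_E_ne_zero hL hq).trans (by linarith)))]

/-- **(2.48) FOR THE GAUGE-FIELD LOCAL PART, LOCATED FORM** (*"Λ large enough"*): if BOTH regions contain every `Λ`-bond variable within torus
distance `(ρ+1)M_c + (L − 1)` of `b` or `b′` (i.e. `dist({b, b′}, Λ_i^c)` exceeds that radius), their local parts at `(b, b′)` coincide — the common
value is the print's `C^{(k)}_{loc}(b, b′)`. [cite: BalabanImbrieJaffe1988, (2.48) p.265, (2.49) p.265] -/
theorem gLoc_eq_of_contains (hL : 0 < L) {Λ₁ Λ₂ : Finset (Fin d → ℤ)} (Δ : Matrix (B4.Idx (pbox M) d) (B4.Idx (pbox M) d) ℝ) (γ : ℝ)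
    {Mc : ℕ} (hM0 : 0 < Mc) {ρ : ℝ} (hρ : 0 ≤ ρ) (b b' : B4.Idx (pbox M) d)
    (h₁ : ∀ r : B4.Idx (pbox M) d,
      pdist M (one_le_M M) (b.1 : Fin d → ℤ) (r.1 : Fin d → ℤ) ≤ (ρ + 1) * Mc + ((L : ℝ) - 1) ∨
        pdist M (one_le_M M) (b'.1 : Fin d → ℤ) (r.1 : Fin d → ℤ) ≤ (ρ + 1) * Mc + ((L : ℝ) - 1) → IsLam L M Λ₁ r)
    (h₂ : ∀ r : B4.Idx (pbox M) d,
      pdist M (one_le_M M) (b.1 : Fin d → ℤ) (r.1 : Fin d → ℤ) ≤ (ρ + 1) * Mc + ((L : ℝ) - 1) ∨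
        pdist M (one_le_M M) (b'.1 : Fin d → ℤ) (r.1 : Fin d → ℤ) ≤ (ρ + 1) * Mc + ((L : ℝ) - 1) → IsLam L M Λ₂ r) :
    sandw L M Λ₁ (cLoc (ldist (N := d) Mc) ρ (walkK L M Λ₁ Δ γ Mc)) b b' =
      sandw L M Λ₂ (cLoc (ldist (N := d) Mc) ρ (walkK L M Λ₂ Δ γ Mc)) b b' :=
  gLoc_congr hL Δ γ hM0 hρ b b' fun r hr => ⟨fun _ => h₂ r hr, fun _ => h₁ r hr⟩

omit [∀ μ, NeZero (M μ)] in
/-- kernel: a variable lying "in X" in p13's sense (`memX`: in a block whose cube closure is inside `X`) has its site among the sites of `X`.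
[cite: BalabanImbrieJaffe1988, (2.46) p.264] -/
theorem mem_sitesOf_of_memX {Mc s : ℕ} {X : Finset (Cubes Mc s (pbox M))} {x : B4.Idx (pbox M) d}
    (h : memX (fun (x : B4.Idx (pbox M) d) (l : ↥(labels Mc (pbox M))) => InBox Mc l.1 (x.1 : Fin d → ℤ)) (cubeOf Mc s) touch x X) :
    (x.1 : Fin d → ℤ) ∈ sitesOf Mc s X := by
  obtain ⟨j, hj, hcl⟩ := h
  exact boxSet_subset_sitesOf (hcl (subset_closure touch _ (Finset.mem_singleton_self _))) (mem_boxSet.2 ⟨x.1.2, hj⟩)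

omit [∀ μ, NeZero (M μ)] in
/-- **(2.48) FOR THE GAUGE-FIELD `X`-PARTS** (p. 265: *"If X does not intersect Λ^c then C^{(k)}_{Λ,X}(u) does not depend on Λ"*, through (2.49)): for ANY
`Δ`, `γ`, cubes `M_c ≥ 1`, `ρ`, `s`, region `X` of `r(e_k)`-cubes and two regions `Λ₁`, `Λ₂` having the same `Λ`-bonds at the sites of `X` (p13's `sitesOf`):
`C^{(k)}_{Λ₁,X}(b, b′) = C^{(k)}_{Λ₂,X}(b, b′)` for all `b, b′` — termwise, no (5.6) (the middle factors agree by `cX_opA_congr`; a contributing remaining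
variable lies in `X`, where membership agrees). [cite: BalabanImbrieJaffe1988, (2.48) p.265, (2.49) p.265] -/
theorem gX_congr {Λ₁ Λ₂ : Finset (Fin d → ℤ)} (Δ : Matrix (B4.Idx (pbox M) d) (B4.Idx (pbox M) d) ℝ) (γ : ℝ) {Mc : ℕ} (hM0 : 0 < Mc)
    (ρ : ℝ) {s : ℕ} (X : Finset (Cubes Mc s (pbox M))) (b b' : B4.Idx (pbox M) d)
    (hS : ∀ r : B4.Idx (pbox M) d, (r.1 : Fin d → ℤ) ∈ sitesOf Mc s X → (IsLam L M Λ₁ r ↔ IsLam L M Λ₂ r)) :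
    sandw L M Λ₁ (cX (ldist (N := d) Mc) ρ (cubeOf Mc s) touch (walkK L M Λ₁ Δ γ Mc) X) b b' =
      sandw L M Λ₂ (cX (ldist (N := d) Mc) ρ (cubeOf Mc s) touch (walkK L M Λ₂ Δ γ Mc) X) b b' := by
  classical
  rw [sandw_eq_sum_E, sandw_eq_sum_E]
  have hcX : ∀ p q, cX (ldist (N := d) Mc) ρ (cubeOf Mc s) touch (walkK L M Λ₁ Δ γ Mc) X p q =
      cX (ldist (N := d) Mc) ρ (cubeOf Mc s) touch (walkK L M Λ₂ Δ γ Mc) X p q := fun p q => cX_opA_congr Δ γ hM0 ρ X p q hS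
  simp_rw [hcX]
  refine sum_sum_eq_of_support _ fun p q hne => ?_
  have hK : cX (ldist (N := d) Mc) ρ (cubeOf Mc s) touch (walkK L M Λ₂ Δ γ Mc) X p q ≠ 0 := fun h =>
    hne (by rw [h, mul_zero, zero_mul])
  have hmem : memX (fun (x : B4.Idx (pbox M) d) (l : ↥(labels Mc (pbox M))) => InBox Mc l.1 (x.1 : Fin d → ℤ)) (cubeOf Mc s) touch p X ∧
      memX (fun (x : B4.Idx (pbox M) d) (l : ↥(labels Mc (pbox M))) => InBox Mc l.1 (x.1 : Fin d → ℤ)) (cubeOf Mc s) touch q X := by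
    by_contra h
    exact hK (cX_support (ldist (N := d) Mc) ρ (cubeOf Mc s) touch
      (fun (x : B4.Idx (pbox M) d) (l : ↥(labels Mc (pbox M))) => InBox Mc l.1 (x.1 : Fin d → ℤ))
      (latticeCw_support hM0 (opA L M Λ₂ Δ γ)) X p q h)
  constructor
  · rw [mem_lamFree, mem_lamFree, hS p (mem_sitesOf_of_memX hmem.1)]
  · rw [mem_lamFree, mem_lamFree, hS q (mem_sitesOf_of_memX hmem.2)]

omit [∀ μ, NeZero (M μ)] in
/-- **(2.48) FOR THE `X`-PARTS, LOCATED FORM** (*"If X does not intersect Λ^c"*): if BOTH regions contain every `Λ`-bond variable based at a site of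
`X`, their `X`-parts coincide everywhere. [cite: BalabanImbrieJaffe1988, (2.48) p.265, (2.49) p.265] -/
theorem gX_eq_of_contains {Λ₁ Λ₂ : Finset (Fin d → ℤ)} (Δ : Matrix (B4.Idx (pbox M) d) (B4.Idx (pbox M) d) ℝ) (γ : ℝ) {Mc : ℕ}
    (hM0 : 0 < Mc) (ρ : ℝ) {s : ℕ} (X : Finset (Cubes Mc s (pbox M))) (b b' : B4.Idx (pbox M) d)
    (h₁ : ∀ r : B4.Idx (pbox M) d, (r.1 : Fin d → ℤ) ∈ sitesOf Mc s X → IsLam L M Λ₁ r)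
    (h₂ : ∀ r : B4.Idx (pbox M) d, (r.1 : Fin d → ℤ) ∈ sitesOf Mc s X → IsLam L M Λ₂ r) :
    sandw L M Λ₁ (cX (ldist (N := d) Mc) ρ (cubeOf Mc s) touch (walkK L M Λ₁ Δ γ Mc) X) b b' =
      sandw L M Λ₂ (cX (ldist (N := d) Mc) ρ (cubeOf Mc s) touch (walkK L M Λ₂ Δ γ Mc) X) b b' :=
  gX_congr Δ γ hM0 ρ X b b' fun r hr => ⟨fun _ => h₂ r hr, fun _ => h₁ r hr⟩

/-! ## §4 NON-VACUITY OF THE HALF-TORUS POSITION: regions whose blocks sit in a coordinate window -/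

omit [∀ μ, NeZero (M μ)] in
/-- kernel: the corner of the (wrapped) successor site: for `x` in the box and the bond `⟨x, x + e_ν⟩`, if the block corner of `x + e_ν` (read modulo the
periods) is `y`, then coordinatewise `y_i ≤ x_i + δ_{iν} < y_i + L`, except that in direction `ν` a wrap (`x_ν = M_ν − 1`) forces `y_ν ≤ 0`.
[cite: Balaban1984PropagatorsII, Lemma 2.4 p.245 (Λ-bonds); dictionary] -/
theorem corner_wrap_succ_bounds (hL : 0 < L) {x : Fin d → ℤ} (hx : x ∈ pbox M) (ν i : Fin d) :
    (B6Elimination.corner L (B6Lemma24Torus.wrap M (x + B6BondElimination.unitVec ν)) i ≤ x i + (if i = ν then 1 else 0) ∧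
        x i < B6Elimination.corner L (B6Lemma24Torus.wrap M (x + B6BondElimination.unitVec ν)) i + L) ∨
      (i = ν ∧ B6Elimination.corner L (B6Lemma24Torus.wrap M (x + B6BondElimination.unitVec ν)) i ≤ 0) := by
  set z := B6Lemma24Torus.wrap M (x + B6BondElimination.unitVec ν) with hz
  have hblk := B6Elimination.mem_block.1 (B6Elimination.mem_block_corner hL z) i
  have hzi : z i = (x i + (if i = ν then 1 else 0)) % (M i : ℤ) := by
    rw [hz]
    show (x + B6BondElimination.unitVec ν) i % (M i : ℤ) = _
    rw [B6BondElimination.add_unitVec_apply]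
  obtain ⟨hx0, hxM⟩ := (B6Lemma24Torus.mem_pbox.1 hx) i
  have hM0 : (0 : ℤ) < (M i : ℤ) := by omega
  by_cases hlt : x i + (if i = ν then 1 else 0) < (M i : ℤ)
  · have hzi' : z i = x i + (if i = ν then 1 else 0) := by
      rw [hzi]
      exact Int.emod_eq_of_lt (by split_ifs <;> omega) hlt
    left
    rw [hzi'] at hblk
    constructor
    · exact hblk.1
    · split_ifs at hblk with hiν <;> omega
  · -- the wrap: `i = ν`, `x_ν = M_ν − 1`, `z_ν = 0`
    have hiν : i = ν := by
      by_contra hne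
      rw [if_neg hne] at hlt
      omega
    have hxe : x i + 1 = (M i : ℤ) := by rw [if_pos hiν] at hlt; omega
    have hz0 : z i = 0 := by
      rw [hzi, if_pos hiν, hxe, Int.emod_self]
    right
    refine ⟨hiν, ?_⟩
    rw [hz0] at hblk
    exact hblk.1

omit [∀ μ, NeZero (M μ)] in
/-- **NON-VACUITY OF `HalfBox`: BLOCKS IN A WINDOW.**  If every point of `Λ′₀` lies, with its whole block, in a coordinate window `[a_μ, a_μ + w_μ)` with
`a_μ ≥ 1` and `2(w_μ + 1) ≤ M_μ`, then `Λ = B(Λ′₀)` is in half-torus position: every `Λ`-bond variable is based at a site of `[a_μ − 1, a_μ + w_μ)` (a bond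
`⟨x, x + e_ν⟩` with `x + e_ν` in a block of `Λ′₀` has `x_ν ≥ a_ν − 1`; no wrap since `a_ν ≥ 1`), so gen 24's `halfBox_of_window` applies — e.g. any union of
blocks inside the first half of the box away from its faces. [cite: BalabanImbrieJaffe1988, (2.48) p.265, (2.49) p.265] -/
theorem halfBox_of_blocks_in_window (hL : 0 < L) {Λ'₀ : Finset (Fin d → ℤ)} (a : Fin d → ℤ) (w : Fin d → ℕ) (ha : ∀ i, 1 ≤ a i)
    (hw : ∀ i, 2 * ((w i : ℤ) + 1) ≤ (M i : ℤ)) (hΛ : ∀ y ∈ Λ'₀, ∀ i, a i ≤ y i ∧ y i + L ≤ a i + w i) :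
    HalfBox L M Λ'₀ := by
  refine halfBox_of_window (fun i => a i - 1) (fun i => w i + 1) (fun i => by push_cast; exact hw i) fun p hp i => ?_
  have hx : (p.1 : Fin d → ℤ) ∈ pbox M := p.1.2
  push_cast
  rcases hp with h | h
  · -- `x` itself lies in a block of `Λ′₀`
    unfold B6LowerBound2153Torus.InLam at h
    rw [B6Lemma24Torus.wrap_eq_self hx] at h
    have hb := B6Elimination.mem_block.1 (B6Elimination.mem_block_corner hL (p.1 : Fin d → ℤ)) i
    have hy := hΛ _ h i
    constructor <;> omega
  · -- `x + e_ν` lies in a block of `Λ′₀`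
    unfold B6LowerBound2153Torus.InLam at h
    have hy := hΛ _ h i
    rcases corner_wrap_succ_bounds (M := M) hL hx p.2 i with ⟨h1, h2⟩ | ⟨-, h0⟩
    · constructor
      · split_ifs at h1 <;> omega
      · have : (L : ℤ) ≥ 1 := by exact_mod_cast hL
        split_ifs at h1 <;> omega
    · have := ha i
      omega

/-! ## §5 «Λ LARGE ENOUGH» UP TO THE WHOLE TORUS: the whole-torus member of the family IS the (4.3.3) propagator of [I] -/

section WholeTorus

open B6Cov2156Torus (bondReductionT bondReductionT_cov)
open B6Cov2156TorusSubset (subFamilyT subFamilyT_cov lamFree_univ)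
open B6Lemma24Torus (coarseSites)
open B6Cov2156TorusDelK (reDelK)
open BIJ85AxialPropagator411 (curlOp V411)
open BIJ85UnitPropagator433 (unitPropagator)
open BIJ85Prop521Torus (QsE)
open BIJ85Ineq723TorusCornerGauge (idx Wcorner kernel_corner_eq_cov L_dvd_Mk)
open BIJ85Eq431DeltaKBridge (one_le_Lpow)
open B5Eq117TorusCarriers (Mk)

omit [∀ μ, NeZero (M μ)] in
/-- kernel: the covariance of a sub-family reduction depends on the kept set only as a set. [folklore] (bookkeeping for (2.156)) -/
private theorem cov_subFamilyT_congr {S S' : Finset (B4.Idx (pbox M) d)} (hS : S ⊆ freeT L M) (hS' : S' ⊆ freeT L M) (h : S = S')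
    (Δ : Matrix (B4.Idx (pbox M) d) (B4.Idx (pbox M) d) ℝ) : (subFamilyT L M S hS Δ).cov = (subFamilyT L M S' hS' Δ).cov := by
  subst h
  rfl

omit [∀ μ, NeZero (M μ)] in
/-- kernel: keeping ALL remaining variables gives back pv09's whole-torus scheme (2.156) (`bondReductionT`). [cite: Balaban1984PropagatorsII, (2.156) p.250] -/
theorem cov_subFamilyT_freeT (Δ : Matrix (B4.Idx (pbox M) d) (B4.Idx (pbox M) d) ℝ) :
    (subFamilyT L M (freeT L M) subset_rfl Δ).cov = (bondReductionT L M Δ).cov := by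
  rw [subFamilyT_cov, bondReductionT_cov]
  rfl

/-- **THE WHOLE TORUS AS A MEMBER OF THE FAMILY**: for `Λ′₀ ⊇ T′` (all coarse sites), `C^{(k)}_Λ = C^{(k)}` of (2.152)/(2.156) on the whole lattice
(pv09's `lamFree_univ`: every bond is a `Λ`-bond). [cite: Balaban1984PropagatorsII, (2.152) p.249 ("on the whole lattice T^{(k)}, or on a subset Λ"), (2.156) p.250] -/
theorem covLam_univ_eq (hL : 0 < L) {Λ'₀ : Finset (Fin d → ℤ)} (hΛ : coarseSites L M ⊆ Λ'₀)
    (Δ : Matrix (B4.Idx (pbox M) d) (B4.Idx (pbox M) d) ℝ) : (bondReductionLam L M Λ'₀ Δ).cov = (bondReductionT L M Δ).cov :=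
  (cov_subFamilyT_congr (lamFree_subset L M Λ'₀) subset_rfl (lamFree_univ hL hΛ) Δ).trans (cov_subFamilyT_freeT Δ)

/-- **… AND ON THE TORI OF THE SERIES IT IS THE (4.3.3) PROPAGATOR OF [I]** (Bałaban's corner axial gauge; p09's `kernel_corner_eq_cov` BY NAME): for
`Λ′₀ ⊇ T′`, `C^{(k)}_Λ(b, b′)` of the genuine `Δ_k` is the kernel `⟨δ_b, C^{(k)}δ_{b′}⟩` of `unitPropagator (V411 P k) (curlOp (η^d) (L^k)) (QsE P k) (Wcorner P k)`,
`d ≥ 2`, `k + 1 ≤ m + K` — the covariance that (2.49) calls *"the single-step covariance for the gauge field"* ([I] (4.3.3)); the walk theorems of gen 24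
apply to the members of the family in half-torus position (*"Λ large enough"*, not the whole torus).
[cite: BalabanImbrieJaffe1988, (2.49) p.265; BalabanImbrieJaffe1985, (4.3.3) p.311; Balaban1984PropagatorsII, (2.156) p.250] -/
theorem covLam_univ_eq_unitPropagator {P : Params} {k : ℕ} [DecidableEq (PBond P k)] (hd : 2 ≤ P.d) (hk : k + 1 ≤ P.m + P.K)
    {Λ'₀ : Finset (Fin P.d → ℤ)} (hΛ : coarseSites P.L (Mk P k) ⊆ Λ'₀) (b b' : PBond P k) :
    (bondReductionLam P.L (Mk P k) Λ'₀ (reDelK (P.L ^ k) (one_le_Lpow P k) (Mk P k))).cov (idx P k b) (idx P k b') =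
      unitPropagator (V411 P k) (curlOp (P := P) (P.eta k ^ P.d) ((P.L : ℝ) ^ k)) (QsE P k) (Wcorner P k) (EuclideanSpace.single b' 1) b := by
  rw [covLam_univ_eq P.L_pos hΛ, kernel_corner_eq_cov hd hk]

end WholeTorus

end

end Literature.MathematicalPhysics.QuantumFieldTheory.BalabanImbrieJaffe1984to88.BIJ88Eq248GaugeCovarianceTorus
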